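import Summits.Langlands.Langlands.Theorems.IrreducibilityBySelfDualityIrreducibleOffSectorSymmPower
import Summits.Langlands.Langlands.Theorems.IrreducibilityBySelfDualityIrreducibleOffSectorRegularAttached
import HarnessLib

/-!
# `IrreducibleOffSector`: the SYMMETRIC-POWER ASCENT operator `Sym^m : GL_2 → GL_{m+1}`
(crux stmt-Langlands-14329 `IrreducibilityBySelfDuality.IrreducibleOffSector`, line `Sketch`;
`--supports` file, STRUCTURAL: no import of the route module; continuation lead c6)

Fifth closure operator on the crux's conclusion (after the twist closure p120193, the base-change
descent p121124, the automorphic-induction ascent p122816 and the tensor-product ascent p124532; the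
one recommended by lead c5).  Let `τ` on `GL_2(𝔸_K)` be an automorphic datum and `Π` on
`GL_{m+1}(𝔸_K)` a WEAK FUNCTORIAL `m`-TH SYMMETRIC POWER of `τ`: at almost all places, if
`t_{τ,v} = {x, y}` then `t_{Π,v} = Sym^m {x, y} = {x^m, x^{m-1} y, …, y^m}` (the unramified local
symmetric-power transfer; a theorem for `m = 2`, Gelbart–Jacquet 1978; `m = 3`, Kim–Shahidi 2002;
`m = 4`, Kim 2003; every `m` for non-CM holomorphic forms over totally real fields, Newton–Thorne
2021).  If `τ` has an `ℓ`-adic avatar `ρ_τ` (Satake–Frobenius compatible a.e.) whose `m`-th symmetric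
power `Sym^m ρ_τ` is IRREDUCIBLE, then EVERY `ρ : Γ_K → GL_{m+1}(ℚ̄_ℓ)` Satake–Frobenius compatible with
`(Π, ι)` at almost all places is irreducible:

* `symmPower_eq_of_formula`, `forall_symmPower_isIrreducible_of_exists` — all framed `m`-th symmetric
  powers of `ρ_τ` are EQUAL (the entry formula determines the matrices), so the hypothesis "every framed
  symmetric power is irreducible" below is the irreducibility of any one of them;
* `eventually_satakeFrobCompatibleAt_symmPower` — `Sym^m ρ_τ` is an a.e.-compatible avatar of `Π`
  (`hasFrobCharpolyAt_symmPower_arithFrobPolyOfSatake`, `isUnramifiedAt_symmPower` of `…SymmPower`,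
  a.e.-unramifiedness of `Π`, `hasSatakeParamAt_cofinite_holds`; Satake parameters of `τ` are pairs,
  `HasSatakeParamAt.card_eq`);
* `isIrreducible_of_isSymmPowerLift` — **the operator**, by the Chebotarev–Brauer–Nesbitt transfer
  `isIrreducible_of_satakeFrobCompatible` (p79199);
* `isIrreducible_of_isSymmPowerLift'` — the same with the avatar supplied by `exists_symmPower`, the
  irreducibility hypothesis quantified over all framed symmetric powers of `ρ_τ`;
* `eventually_satakeFrobCompatibleAt_of_twist_attached`, `exists_semisimple_avatar_of_isRegular` —
  modulo lang.S27 (the text of the route input `GaloisRepOfRegularAlgebraic`), a cuspidal `π` on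
  `GL_n` over a totally real or CM field, L-algebraic with a regular infinity type, HAS a semisimple
  a.e.-compatible avatar at every `(ℓ, ι)` (the representation attached to `π ⊗ |det|^{(n-1)/2}`,
  through the half-twist bridge of `…RegularAttached`); `isIrreducible_of_isSymmPowerLift_of_isRegular`
  — the operator for regular `τ` over such fields, the irreducibility hypothesis on the symmetric powers
  of the semisimple avatars of `τ`;
* `irreducibleOffSector_conclusion_of_symmPowerLift` — binder shape of the crux.

What it opens (for the planner's map of the open content): the region of cuspidal `Π` on `GL_{m+1}`
over totally real (or CM) `K` that are symmetric-power lifts of regular algebraic cuspidal `τ` on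
`GL_2` with lang.S27 avatars (Hilbert newforms of weight `≥ 2`): there the crux reduces to the
irreducibility of ONE symmetric power `Sym^m ρ_{τ,λ}` at the given `λ` — classical for non-CM `τ`
(the image of `ρ_{τ,λ}` contains an open subgroup of `SL_2(ℤ_ℓ)`, Ribet / Momose / Nekovář, so every
`Sym^m ρ_{τ,λ}` is irreducible).  At `m + 1 = 4` this is the symmetric-cube (essentially self-dual,
symplectic) part of the region `H4att` of the certified map, complementary to the non-self-dual part
closed by `…RankFourTotallyReal` (p125438).  Nothing is assumed about cuspidality of `Π`: the operator
is a statement about compatible systems.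

References: S. Gelbart, H. Jacquet, ASENS 11 (1978), Thm. 9.3; H. Kim, F. Shahidi, Ann. of Math. 155
(2002), Thm. B; H. Kim, JAMS 16 (2003); J. Newton, J. Thorne, Publ. IHÉS 134 (2021), Thm. A;
J.-P. Serre, *Linear representations of finite groups* (1977), §1.5; K. Buzzard, T. Gee, LMS LNS 414
(2014), §2.1, Conj. 3.2.1.
-/

noncomputable section

set_option linter.dupNamespace false

open scoped Polynomial MatrixGroups
open MvPolynomial Finsupp

namespace Summit.Langlands.Langlands.Theorems.IrreducibleOffSector

/-! ## 11a. All framed symmetric powers of `ρ` coincide -/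

section Unique

open Literature.NumberTheory.GaloisRepresentations

variable {G : Type*} [Group G] [TopologicalSpace G] {A : Type*} [CommRing A] [TopologicalSpace A] {m : ℕ}
  {ρ : FramedRep G A 2}

/-- **Two framed `m`-th symmetric powers of `ρ` are equal**: the binary-form entry formula determines
every matrix entry.  So "every framed symmetric power of `ρ` is irreducible" (the hypothesis of
`isIrreducible_of_isSymmPowerLift'`) is the irreducibility of any one of them. [folklore] -/
theorem symmPower_eq_of_formula {ρm ρm' : FramedRep G A (m + 1)}
    (hρm : ∀ (g : G) (i j : Fin (m + 1)),
      ((ρm g : GL (Fin (m + 1)) A) : Matrix (Fin (m + 1)) (Fin (m + 1)) A) i j =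
        coeff (single 0 (m - i) + single 1 (i : ℕ))
          (bind₁ (fun i : Fin 2 => ∑ k : Fin 2,
              C (((ρ g : GL (Fin 2) A) : Matrix (Fin 2) (Fin 2) A) k i) * X k)
            (X 0 ^ (m - j) * X 1 ^ (j : ℕ))))
    (hρm' : ∀ (g : G) (i j : Fin (m + 1)),
      ((ρm' g : GL (Fin (m + 1)) A) : Matrix (Fin (m + 1)) (Fin (m + 1)) A) i j =
        coeff (single 0 (m - i) + single 1 (i : ℕ))
          (bind₁ (fun i : Fin 2 => ∑ k : Fin 2,
              C (((ρ g : GL (Fin 2) A) : Matrix (Fin 2) (Fin 2) A) k i) * X k)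
            (X 0 ^ (m - j) * X 1 ^ (j : ℕ)))) :
    ρm = ρm' := by
  apply ContinuousMonoidHom.ext
  intro g
  apply Units.ext
  ext i j
  rw [hρm, hρm']

/-- **Irreducibility of ONE framed symmetric power gives it for all** (they are equal,
`symmPower_eq_of_formula`). [folklore] -/
theorem forall_symmPower_isIrreducible_of_exists {F : Type*} [Field F] [TopologicalSpace F]
    [IsTopologicalRing F] {ρ : FramedRep G F 2} {ρm₀ : FramedRep G F (m + 1)}
    (hρm₀ : ∀ (g : G) (i j : Fin (m + 1)),
      ((ρm₀ g : GL (Fin (m + 1)) F) : Matrix (Fin (m + 1)) (Fin (m + 1)) F) i j =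
        coeff (single 0 (m - i) + single 1 (i : ℕ))
          (bind₁ (fun i : Fin 2 => ∑ k : Fin 2,
              C (((ρ g : GL (Fin 2) F) : Matrix (Fin 2) (Fin 2) F) k i) * X k)
            (X 0 ^ (m - j) * X 1 ^ (j : ℕ))))
    (hirr₀ : ρm₀.toContinuousRep.IsIrreducible) :
    ∀ ρm : FramedRep G F (m + 1),
      (∀ (g : G) (i j : Fin (m + 1)),
        ((ρm g : GL (Fin (m + 1)) F) : Matrix (Fin (m + 1)) (Fin (m + 1)) F) i j =
          coeff (single 0 (m - i) + single 1 (i : ℕ))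
            (bind₁ (fun i : Fin 2 => ∑ k : Fin 2,
                C (((ρ g : GL (Fin 2) F) : Matrix (Fin 2) (Fin 2) F) k i) * X k)
              (X 0 ^ (m - j) * X 1 ^ (j : ℕ)))) →
      ρm.toContinuousRep.IsIrreducible := by
  intro ρm hρm
  rw [symmPower_eq_of_formula hρm hρm₀]
  exact hirr₀

end Unique

/-! ## 11. The SYMMETRIC-POWER ASCENT operator -/

section Ascent

open scoped NumberField Classical
open Filter IsDedekindDomain Literature.NumberTheory.Automorphic
  Literature.NumberTheory.GaloisRepresentations Summit.Langlands

variable {K : Type} [Field K] [NumberField K] {ℓ : ℕ} [Fact ℓ.Prime] {m : ℕ}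
  {h2 : isCompact_glFiniteIntegralLevel 2 K} {hm : isCompact_glFiniteIntegralLevel (m + 1) K}

/-- **The symmetric power of an avatar is an avatar of the symmetric-power lift.**  Let `Π` on
`GL_{m+1}(𝔸_K)` be a weak functorial `m`-th symmetric power of `τ` on `GL_2(𝔸_K)`: at almost all
places, if `t_{τ,v} = {x, y}` then `t_{Π,v} = Sym^m {x, y} = {x^{m-j} y^{j} : 0 ≤ j ≤ m}`; let `ρ_τ` be
Satake–Frobenius compatible with `(τ, ι)` at almost all places and `ρ_m` a framed `m`-th symmetric
power of `ρ_τ` (binary-form matrices).  Then `ρ_m` is Satake–Frobenius compatible with `(Π, ι)` at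
almost all places (`hasFrobCharpolyAt_symmPower_arithFrobPolyOfSatake`, `isUnramifiedAt_symmPower`,
a.e.-unramifiedness of `Π`). [cite: BuzzardGeeLMS2014, §2.1 and Conj. 3.2.1] -/
theorem eventually_satakeFrobCompatibleAt_symmPower (ι : PadicAlgCl ℓ ≃+* ℂ)
    (τ : AutomorphicRepData (AutomorphyDatum.gl 2 K h2))
    (P : AutomorphicRepData (AutomorphyDatum.gl (m + 1) K hm))
    (hSym : ∀ᶠ v : HeightOneSpectrum (𝓞 K) in cofinite, ∀ (x y : ℂ) (γ : Multiset ℂ),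
      τ.HasSatakeParamAt v {x, y} → P.HasSatakeParamAt v γ →
        γ = (Multiset.range (m + 1)).map fun j => x ^ (m - j) * y ^ j)
    {ρτ : FramedGaloisRep K (PadicAlgCl ℓ) 2}
    (hτ : ∀ᶠ v : HeightOneSpectrum (𝓞 K) in cofinite, SatakeFrobCompatibleAt ι τ ρτ v)
    {ρm : FramedGaloisRep K (PadicAlgCl ℓ) (m + 1)}
    (hρm : ∀ (g : Field.absoluteGaloisGroup K) (i j : Fin (m + 1)),
      ((ρm g : GL (Fin (m + 1)) (PadicAlgCl ℓ)) : Matrix (Fin (m + 1)) (Fin (m + 1)) (PadicAlgCl ℓ)) i j =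
        coeff (single 0 (m - i) + single 1 (i : ℕ))
          (bind₁ (fun i : Fin 2 => ∑ k : Fin 2,
              C (((ρτ g : GL (Fin 2) (PadicAlgCl ℓ)) : Matrix (Fin 2) (Fin 2) (PadicAlgCl ℓ)) k i) * X k)
            (X 0 ^ (m - j) * X 1 ^ (j : ℕ)))) :
    ∀ᶠ v : HeightOneSpectrum (𝓞 K) in cofinite, SatakeFrobCompatibleAt ι P ρm v := by
  filter_upwards [hSym, hτ, AutomorphicRepData.hasSatakeParamAt_cofinite_holds P] with v hSv hτv hPv
  obtain ⟨α, hα, hur, hcp⟩ := hτv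
  obtain ⟨γ, hγ⟩ := hPv
  -- the Satake parameter of `τ` at `v` is a pair
  obtain ⟨x, y, rfl⟩ := Multiset.card_eq_two.mp hα.card_eq
  refine ⟨γ, hγ, isUnramifiedAt_symmPower hρm hur, ?_⟩
  rw [hSv x y γ hα hγ]
  exact hasFrobCharpolyAt_symmPower_arithFrobPolyOfSatake hρm ι v.residueCard hcp

/-- **SYMMETRIC-POWER ASCENT of the crux's conclusion.**  Let `Π` on `GL_{m+1}(𝔸_K)` be a weak
functorial `m`-th symmetric power of `τ` on `GL_2(𝔸_K)` (`t_{Π,v} = Sym^m t_{τ,v}` a.e.; Gelbart–Jacquet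
`m = 2`, Kim–Shahidi `m = 3`, Kim `m = 4`, Newton–Thorne every `m` for holomorphic forms over totally
real fields), let `ρ_τ` be an avatar of `τ` (a.e.-compatible with `ι`) and `ρ_m` a framed `m`-th
symmetric power of `ρ_τ` which is IRREDUCIBLE.  Then every `ρ : Γ_K → GL_{m+1}(ℚ̄_ℓ)` Satake–Frobenius
compatible with `(Π, ι)` at almost all places is irreducible: `ρ_m` is an irreducible a.e.-compatible
avatar of `Π` (`eventually_satakeFrobCompatibleAt_symmPower`) and the Chebotarev–Brauer–Nesbitt
transfer `isIrreducible_of_satakeFrobCompatible` (p79199) applies.  No cuspidality of `Π` is used.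
[cite: BuzzardGeeLMS2014, Conj. 3.2.1] [cite: SerreLinearRepresentations1977, §1.5] -/
theorem isIrreducible_of_isSymmPowerLift (ι : PadicAlgCl ℓ ≃+* ℂ)
    (τ : AutomorphicRepData (AutomorphyDatum.gl 2 K h2))
    (P : AutomorphicRepData (AutomorphyDatum.gl (m + 1) K hm))
    (hSym : ∀ᶠ v : HeightOneSpectrum (𝓞 K) in cofinite, ∀ (x y : ℂ) (γ : Multiset ℂ),
      τ.HasSatakeParamAt v {x, y} → P.HasSatakeParamAt v γ →
        γ = (Multiset.range (m + 1)).map fun j => x ^ (m - j) * y ^ j)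
    {ρτ : FramedGaloisRep K (PadicAlgCl ℓ) 2}
    (hτ : ∀ᶠ v : HeightOneSpectrum (𝓞 K) in cofinite, SatakeFrobCompatibleAt ι τ ρτ v)
    {ρm : FramedGaloisRep K (PadicAlgCl ℓ) (m + 1)}
    (hρm : ∀ (g : Field.absoluteGaloisGroup K) (i j : Fin (m + 1)),
      ((ρm g : GL (Fin (m + 1)) (PadicAlgCl ℓ)) : Matrix (Fin (m + 1)) (Fin (m + 1)) (PadicAlgCl ℓ)) i j =
        coeff (single 0 (m - i) + single 1 (i : ℕ))
          (bind₁ (fun i : Fin 2 => ∑ k : Fin 2,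
              C (((ρτ g : GL (Fin 2) (PadicAlgCl ℓ)) : Matrix (Fin 2) (Fin 2) (PadicAlgCl ℓ)) k i) * X k)
            (X 0 ^ (m - j) * X 1 ^ (j : ℕ))))
    (hirr : ρm.toGaloisRep.IsIrreducible)
    (ρ : FramedGaloisRep K (PadicAlgCl ℓ) (m + 1))
    (hρ : ∀ᶠ v : HeightOneSpectrum (𝓞 K) in cofinite, SatakeFrobCompatibleAt ι P ρ v) :
    ρ.toGaloisRep.IsIrreducible :=
  isIrreducible_of_satakeFrobCompatible P ι hirr
    (eventually_satakeFrobCompatibleAt_symmPower ι τ P hSym hτ hρm) hρ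

/-- **Symmetric-power ascent, avatar-free form.**  As `isIrreducible_of_isSymmPowerLift`, with the
framed symmetric power supplied by `exists_symmPower` and the irreducibility hypothesis stated for
every framed `m`-th symmetric power of `ρ_τ` (they all have the same matrices).
[cite: BuzzardGeeLMS2014, Conj. 3.2.1] -/
theorem isIrreducible_of_isSymmPowerLift' (ι : PadicAlgCl ℓ ≃+* ℂ)
    (τ : AutomorphicRepData (AutomorphyDatum.gl 2 K h2))
    (P : AutomorphicRepData (AutomorphyDatum.gl (m + 1) K hm))
    (hSym : ∀ᶠ v : HeightOneSpectrum (𝓞 K) in cofinite, ∀ (x y : ℂ) (γ : Multiset ℂ),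
      τ.HasSatakeParamAt v {x, y} → P.HasSatakeParamAt v γ →
        γ = (Multiset.range (m + 1)).map fun j => x ^ (m - j) * y ^ j)
    (ρτ : FramedGaloisRep K (PadicAlgCl ℓ) 2)
    (hτ : ∀ᶠ v : HeightOneSpectrum (𝓞 K) in cofinite, SatakeFrobCompatibleAt ι τ ρτ v)
    (hirr : ∀ ρm : FramedGaloisRep K (PadicAlgCl ℓ) (m + 1),
      (∀ (g : Field.absoluteGaloisGroup K) (i j : Fin (m + 1)),
        ((ρm g : GL (Fin (m + 1)) (PadicAlgCl ℓ)) :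
            Matrix (Fin (m + 1)) (Fin (m + 1)) (PadicAlgCl ℓ)) i j =
          coeff (single 0 (m - i) + single 1 (i : ℕ))
            (bind₁ (fun i : Fin 2 => ∑ k : Fin 2,
                C (((ρτ g : GL (Fin 2) (PadicAlgCl ℓ)) : Matrix (Fin 2) (Fin 2) (PadicAlgCl ℓ)) k i) *
                  X k)
              (X 0 ^ (m - j) * X 1 ^ (j : ℕ)))) →
      ρm.toGaloisRep.IsIrreducible)
    (ρ : FramedGaloisRep K (PadicAlgCl ℓ) (m + 1))
    (hρ : ∀ᶠ v : HeightOneSpectrum (𝓞 K) in cofinite, SatakeFrobCompatibleAt ι P ρ v) :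
    ρ.toGaloisRep.IsIrreducible := by
  obtain ⟨ρm, hρm⟩ := exists_symmPower (m := m) ρτ
  exact isIrreducible_of_isSymmPowerLift ι τ P hSym hτ hρm (hirr ρm hρm) ρ hρ

end Ascent

/-! ## 11b. Avatars of regular `τ` over totally real / CM fields (lang.S27 through the half-twist) -/

section Attached

open scoped NumberField Classical
open Filter IsDedekindDomain NumberField Literature.NumberTheory.Automorphic
  Literature.NumberTheory.GaloisRepresentations Summit.Langlands

variable {n : ℕ} {K : Type} [Field K] [NumberField K] {hcpt : isCompact_glFiniteIntegralLevel n K}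
  {ℓ : ℕ} [Fact ℓ.Prime]

/-- **The representation attached to the regular algebraic twist is an avatar.**  Let
`π' = π ⊗ |det|^{(n-1)/2}` (`W_{π'} = |det|^{(n-1)/2} W_π`, same for `W'`) and let `r` be compatible with
`(π', ι)` at every finite `v ∤ ℓ` in the C-normalisation `arithFrobPolyOfSatake ι q_v n β` (the shape of
lang.S27).  Then `r` is Satake–Frobenius compatible with `(π, ι)` at almost all places in the summit's
L-normalisation (`t_{π',v} = q_v^{-(n-1)/2} t_{π,v}` and
`arithFrobPolyOfSatake ι q_v n (q_v^{-(n-1)/2} α) = arithFrobPolyOfSatake ι q_v 1 α`, Buzzard–Gee §5.3).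
[cite: BuzzardGeeLMS2014, §5.3] -/
theorem eventually_satakeFrobCompatibleAt_of_twist_attached (hn : 1 ≤ n) (ι : PadicAlgCl ℓ ≃+* ℂ)
    {π π' : AutomorphicRepData (AutomorphyDatum.gl n K hcpt)} {χ : HeckeCharacter K}
    (hχ : ∀ x : ideleGroup K,
      ((χ x : ℂˣ) : ℂ) = (ideleNorm x : ℂ) ^ ((((n : ℝ) - 1) / 2 : ℝ) : ℂ))
    (hW : π'.W = π.W.map (mulChar (detTwist n χ)))
    (hW' : π'.W' = π.W'.map (mulChar (detTwist n χ)))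
    {r : FramedGaloisRep K (PadicAlgCl ℓ) n}
    (hr : ∀ (v : HeightOneSpectrum (𝓞 K)) (β : Multiset ℂ), π'.HasSatakeParamAt v β →
      ((ℓ : ℕ) : 𝓞 K) ∉ v.asIdeal →
        r.IsUnramifiedAt v ∧ r.HasFrobCharpolyAt v (arithFrobPolyOfSatake ι v.residueCard n β)) :
    ∀ᶠ v : HeightOneSpectrum (𝓞 K) in cofinite, SatakeFrobCompatibleAt ι π r v := by
  filter_upwards [AutomorphicRepData.hasSatakeParamAt_cofinite_holds π,
    FramedGaloisRep.eventually_natCast_not_mem K ℓ] with v hπv hℓ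
  obtain ⟨α, hα⟩ := hπv
  have hβ := AutomorphicRepData.HasSatakeParamAt.of_map_mulChar_detTwist_of_cpow hχ hW hW' hα
  obtain ⟨hur, hcp⟩ := hr v _ hβ hℓ
  rw [arithFrobPolyOfSatake_map_cpow_neg_half ι (lt_trans zero_lt_one v.one_lt_residueCard) hn] at hcp
  exact ⟨α, hα, hur, hcp⟩

/-- **Regular `π` over totally real / CM fields have semisimple a.e.-compatible avatars** (modulo
lang.S27, the text of the route input `GaloisRepOfRegularAlgebraic`): for `π` cuspidal on `GL_n(𝔸_K)`,
L-algebraic with a regular infinity type, `K` totally real or CM, and every `ℓ`, `ι`, there is a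
semisimple `r : Γ_K → GL_n(ℚ̄_ℓ)` Satake–Frobenius compatible with `(π, ι)` at almost all places — the
representation attached to the regular algebraic twist `π ⊗ |det|^{(n-1)/2}`.
[cite: HarrisLanTaylorThorneRMS2016, Thm. A] [cite: BuzzardGeeLMS2014, §5.3] -/
theorem exists_semisimple_avatar_of_isRegular [NeZero n]
    (hGR : ∀ (n : ℕ) (K : Type) [Field K] [NumberField K] (hcpt : Literature.NumberTheory.Automorphic.isCompact_glFiniteIntegralLevel n K), (NumberField.IsTotallyReal K ∨ NumberField.IsCMField K) → ∀ (π : Literature.NumberTheory.Automorphic.CuspidalAutomorphicRepData n K hcpt), π.1.IsRegularAlgebraic → ∀ (ℓ : ℕ) [Fact ℓ.Prime] (ι : PadicAlgCl ℓ ≃+* ℂ), ∃ r : Literature.NumberTheory.GaloisRepresentations.FramedGaloisRep K (PadicAlgCl ℓ) n, r.toGaloisRep.IsSemisimple ∧ ∀ (v : IsDedekindDomain.HeightOneSpectrum (NumberField.RingOfIntegers K)) (α : Multiset ℂ), π.1.HasSatakeParamAt v α → ((ℓ : ℕ) : NumberField.RingOfIntegers K) ∉ v.asIdeal → r.IsUnramifiedAt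 v ∧ r.HasFrobCharpolyAt v (Literature.NumberTheory.Automorphic.arithFrobPolyOfSatake ι v.residueCard n α))
    (hK : IsTotallyReal K ∨ IsCMField K) (ι : PadicAlgCl ℓ ≃+* ℂ)
    (π : CuspidalAutomorphicRepData n K hcpt) (hL : π.1.IsLAlgebraic)
    (hreg : ∃ T : InfinityType K n, π.1.HasInfinityType T ∧ T.IsRegular) :
    ∃ r : FramedGaloisRep K (PadicAlgCl ℓ) n, r.toGaloisRep.IsSemisimple ∧
      ∀ᶠ v : HeightOneSpectrum (𝓞 K) in cofinite, SatakeFrobCompatibleAt ι π.1 r v := by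
  obtain ⟨T, hT, hTL, hTR⟩ := exists_infinityType_isLAlgebraic_isRegular π.1 hL hreg
  obtain ⟨χ, π', hχ, hW, hW', hT'⟩ := π.exists_twist_hasInfinityType (((n : ℝ) - 1) / 2) hT
  have hRA : π'.1.IsRegularAlgebraic :=
    isRegularAlgebraic_of_hasInfinityType_twist_half (by exact_mod_cast hT') hTL hTR
  obtain ⟨r, hss, hr⟩ := hGR n K hcpt hK π' hRA ℓ ι
  exact ⟨r, hss, eventually_satakeFrobCompatibleAt_of_twist_attached NeZero.one_le ι hχ hW hW' hr⟩

/-- **Symmetric-power ascent from a REGULAR `τ` over a totally real / CM field** (modulo lang.S27).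
Let `K` be totally real or CM, `τ` cuspidal on `GL_2(𝔸_K)`, L-algebraic with a regular infinity type,
and `Π` on `GL_{m+1}(𝔸_K)` a weak functorial `m`-th symmetric power of `τ`.  Suppose that for the given
`ℓ`, `ι`, every SEMISIMPLE a.e.-compatible avatar `ρ_τ` of `τ` (they exist,
`exists_semisimple_avatar_of_isRegular`, and are all equivalent by Chebotarev–Brauer–Nesbitt) has all
its framed `m`-th symmetric powers irreducible.  Then every `ρ` Satake–Frobenius compatible with
`(Π, ι)` a.e. is irreducible. [cite: HarrisLanTaylorThorneRMS2016, Thm. A]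
[cite: BuzzardGeeLMS2014, Conj. 3.2.1] -/
theorem isIrreducible_of_isSymmPowerLift_of_isRegular
    (hGR : ∀ (n : ℕ) (K : Type) [Field K] [NumberField K] (hcpt : Literature.NumberTheory.Automorphic.isCompact_glFiniteIntegralLevel n K), (NumberField.IsTotallyReal K ∨ NumberField.IsCMField K) → ∀ (π : Literature.NumberTheory.Automorphic.CuspidalAutomorphicRepData n K hcpt), π.1.IsRegularAlgebraic → ∀ (ℓ : ℕ) [Fact ℓ.Prime] (ι : PadicAlgCl ℓ ≃+* ℂ), ∃ r : Literature.NumberTheory.GaloisRepresentations.FramedGaloisRep K (PadicAlgCl ℓ) n, r.toGaloisRep.IsSemisimple ∧ ∀ (v : IsDedekindDomain.HeightOneSpectrum (NumberField.RingOfIntegers K)) (α : Multiset ℂ), π.1.HasSatakeParamAt v α → ((ℓ : ℕ) : NumberField.RingOfIntegers K) ∉ v.asIdeal → r.IsUnramifiedAt v ∧ r.HasFrobCharpolyAt v (Literature.NumberTheory.Automorphic.arithFrobPolyOfSatake ι v.residueCard n α))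
    (hK : IsTotallyReal K ∨ IsCMField K) {m : ℕ} {h2 : isCompact_glFiniteIntegralLevel 2 K}
    {hm : isCompact_glFiniteIntegralLevel (m + 1) K} (ι : PadicAlgCl ℓ ≃+* ℂ)
    (τ : CuspidalAutomorphicRepData 2 K h2) (hL : τ.1.IsLAlgebraic)
    (hreg : ∃ T : InfinityType K 2, τ.1.HasInfinityType T ∧ T.IsRegular)
    (P : AutomorphicRepData (AutomorphyDatum.gl (m + 1) K hm))
    (hSym : ∀ᶠ v : HeightOneSpectrum (𝓞 K) in cofinite, ∀ (x y : ℂ) (γ : Multiset ℂ),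
      τ.1.HasSatakeParamAt v {x, y} → P.HasSatakeParamAt v γ →
        γ = (Multiset.range (m + 1)).map fun j => x ^ (m - j) * y ^ j)
    (hirr : ∀ ρτ : FramedGaloisRep K (PadicAlgCl ℓ) 2, ρτ.toGaloisRep.IsSemisimple →
      (∀ᶠ v : HeightOneSpectrum (𝓞 K) in cofinite, SatakeFrobCompatibleAt ι τ.1 ρτ v) →
      ∀ ρm : FramedGaloisRep K (PadicAlgCl ℓ) (m + 1),
        (∀ (g : Field.absoluteGaloisGroup K) (i j : Fin (m + 1)),
          ((ρm g : GL (Fin (m + 1)) (PadicAlgCl ℓ)) :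
              Matrix (Fin (m + 1)) (Fin (m + 1)) (PadicAlgCl ℓ)) i j =
            coeff (single 0 (m - i) + single 1 (i : ℕ))
              (bind₁ (fun i : Fin 2 => ∑ k : Fin 2,
                  C (((ρτ g : GL (Fin 2) (PadicAlgCl ℓ)) : Matrix (Fin 2) (Fin 2) (PadicAlgCl ℓ)) k i) *
                    X k)
                (X 0 ^ (m - j) * X 1 ^ (j : ℕ)))) →
        ρm.toGaloisRep.IsIrreducible)
    (ρ : FramedGaloisRep K (PadicAlgCl ℓ) (m + 1))
    (hρ : ∀ᶠ v : HeightOneSpectrum (𝓞 K) in cofinite, SatakeFrobCompatibleAt ι P ρ v) :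
    ρ.toGaloisRep.IsIrreducible := by
  haveI : NeZero (2 : ℕ) := ⟨two_ne_zero⟩
  obtain ⟨ρτ, hss, hτ⟩ := exists_semisimple_avatar_of_isRegular hGR hK ι τ hL hreg
  exact isIrreducible_of_isSymmPowerLift' ι τ.1 P hSym ρτ hτ (hirr ρτ hss hτ) ρ hρ

end Attached

/-! ## 12. In the binder shape of the crux -/

section Binder

open scoped NumberField Classical
open Filter IsDedekindDomain Literature.NumberTheory.Automorphic
  Literature.NumberTheory.GaloisRepresentations Summit.Langlands

/-- **The symmetric-power-lift region of `IrreducibleOffSector`** (binder shape of the crux at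
rank `n = m + 1`; every `m`, `K`; the cuspidality / L-algebraicity / off-sector hypotheses are
carried, not used): if `π` on `GL_{m+1}(𝔸_K)` is a weak functorial `m`-th symmetric power of an
automorphic datum `τ` on `GL_2(𝔸_K)` such that for every `ℓ`, `ι` there is an avatar `ρ_τ` of `τ`
all of whose framed `m`-th symmetric powers are irreducible, then every `ρ` Satake–Frobenius
compatible with `(π, ι)` a.e. is irreducible. [cite: BuzzardGeeLMS2014, Conj. 3.2.1] -/
theorem irreducibleOffSector_conclusion_of_symmPowerLift :
    ∀ (m : ℕ) (K : Type) [Field K] [NumberField K]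
      (hcpt : isCompact_glFiniteIntegralLevel (m + 1) K),
      0 < m + 1 → ∀ (π : CuspidalAutomorphicRepData (m + 1) K hcpt),
        (∃ (h2 : isCompact_glFiniteIntegralLevel 2 K)
            (τ : AutomorphicRepData (AutomorphyDatum.gl 2 K h2)),
          (∀ᶠ v : HeightOneSpectrum (𝓞 K) in cofinite, ∀ (x y : ℂ) (γ : Multiset ℂ),
            τ.HasSatakeParamAt v {x, y} → π.1.HasSatakeParamAt v γ →
              γ = (Multiset.range (m + 1)).map fun j => x ^ (m - j) * y ^ j) ∧
          ∀ (ℓ : ℕ) [Fact ℓ.Prime] (ι : PadicAlgCl ℓ ≃+* ℂ),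
            ∃ ρτ : FramedGaloisRep K (PadicAlgCl ℓ) 2,
              (∀ᶠ v : HeightOneSpectrum (𝓞 K) in cofinite, SatakeFrobCompatibleAt ι τ ρτ v) ∧
              ∀ ρm : FramedGaloisRep K (PadicAlgCl ℓ) (m + 1),
                (∀ (g : Field.absoluteGaloisGroup K) (i j : Fin (m + 1)),
                  ((ρm g : GL (Fin (m + 1)) (PadicAlgCl ℓ)) :
                      Matrix (Fin (m + 1)) (Fin (m + 1)) (PadicAlgCl ℓ)) i j =
                    coeff (single 0 (m - i) + single 1 (i : ℕ))
                      (bind₁ (fun i : Fin 2 => ∑ k : Fin 2,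
                          C (((ρτ g : GL (Fin 2) (PadicAlgCl ℓ)) :
                              Matrix (Fin 2) (Fin 2) (PadicAlgCl ℓ)) k i) * X k)
                        (X 0 ^ (m - j) * X 1 ^ (j : ℕ)))) →
                ρm.toGaloisRep.IsIrreducible) →
        π.1.IsLAlgebraic →
        ¬ (m + 1 = 3 ∧ NumberField.IsCMField K ∧
            ∃ T : InfinityType K (m + 1), π.1.HasInfinityType T ∧ T.IsRegular) →
        ∀ (ℓ : ℕ) [Fact ℓ.Prime] (ι : PadicAlgCl ℓ ≃+* ℂ)
          (ρ : FramedGaloisRep K (PadicAlgCl ℓ) (m + 1)),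
          (∀ᶠ v : HeightOneSpectrum (𝓞 K) in cofinite, SatakeFrobCompatibleAt ι π.1 ρ v) →
            ρ.toGaloisRep.IsIrreducible := by
  intro m K _ _ hcpt _hn π hL _hLalg _hsec ℓ _ ι ρ hρ
  obtain ⟨h2, τ, hSym, hav⟩ := hL
  obtain ⟨ρτ, hτ, hirr⟩ := hav ℓ ι
  exact isIrreducible_of_isSymmPowerLift' ι τ π.1 hSym ρτ hτ hirr ρ hρ

end Binder

end Summit.Langlands.Langlands.Theorems.IrreducibleOffSector

end
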